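import Summits.KontsevichZagierPeriods.KontsevichZagierPeriods.Theorems.SymplecticScissorsVolumeFormOffPlaneAffineOrbitPairs
import Summits.KontsevichZagierPeriods.KontsevichZagierPeriods.Theorems.SymplecticScissorsVolumeFormOffPlaneIndicatorInclusionExclusion
import Summits.KontsevichZagierPeriods.KontsevichZagierPeriods.Theorems.SymplecticScissorsVolumeFormOffPlaneBoxUnionPairs

/-!
# `VolumeFormOffPlane` (stmt-KontsevichZagierPeriods-14935) — line `Sketch`,
stub `stub_algebraicBoxUnionPairs` (pairs of FINITE UNIONS of Euclidean boxes with real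
algebraic corners, overlaps allowed)

The Euclidean twin of `stub_boxUnionPairs`: plain Lebesgue volume on `ℝᵈ`, finitely many open
boxes `BOX i = {a i ι < x ι < b i ι}` with REAL ALGEBRAIC corners, in any position, overlaps and
empty boxes allowed. Two integrand-`1` representations whose domains are such finite unions and
whose values agree are KZ-equivalent.

Proof (bookkeeping over the landed affine-orbit interface `affineOrbitPairs`, body `B` = the open
unit cube):
* cells are indexed by `S : Finset (Fin k)`; for non-empty `S` the intersection `⋂ i ∈ S, BOX i`
  is again a box (coordinatewise maximal lower corner, minimal upper corner — both are corners of
  some `BOX i`, hence real algebraic); if it is non-degenerate it is the affine image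
  `diag(B - A) · (0,1)ᵈ + A` of the unit cube, otherwise it is empty;
* weights `c S = (-1)^{|S|+1}` for non-empty `S` with non-empty cell, `0` otherwise: the generic
  inclusion–exclusion identity for indicator functions (`stub_indicatorInclusionExclusion`) is the
  required decomposition, the killed terms having identically vanishing indicator.

Sources: M. Kontsevich, D. Zagier, *Periods* (2001), §1.2 (rules (1), (2)); the bookkeeping is
folklore.
-/

noncomputable section

open MeasureTheory Set
open Literature.NumberTheory.Transcendental
open Literature.ModelTheory.ExponentialFields (IsSemialgebraic isSemialgebraic_empty
  isSemialgebraic_univ isSemialgebraic_setOf_eval_pos)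

namespace Summit.KontsevichZagierPeriods.SymplecticScissors.LogPolytope

/-! ## The body: the open unit cube -/

/-- The open unit cube `(0,1)ᵈ` is `ℚ`-semialgebraic (`0 < u ι`, `0 < 1 - u ι`). [folklore] -/
theorem abup_isSemialgebraic_unitCube (d : ℕ) :
    IsSemialgebraic ℚ {u : Fin d → ℝ | ∀ ι, 0 < u ι ∧ u ι < 1} := by
  have h : {u : Fin d → ℝ | ∀ ι, 0 < u ι ∧ u ι < 1} = ⋂ ι ∈ (Finset.univ : Finset (Fin d)),
      ({u : Fin d → ℝ | 0 < MvPolynomial.aeval u (MvPolynomial.X ι : MvPolynomial (Fin d) ℚ)} ∩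
        {u | 0 < MvPolynomial.aeval u (1 - MvPolynomial.X ι : MvPolynomial (Fin d) ℚ)}) := by
    ext u
    simp [sub_pos, forall_and]
  rw [h]
  exact IsSemialgebraic.biInter _ _ fun ι _ =>
    (isSemialgebraic_setOf_eval_pos _).inter (isSemialgebraic_setOf_eval_pos _)

/-- The open unit cube `(0,1)ᵈ` has finite volume (it sits in the compact cube `[0,1]ᵈ`).
[folklore] -/
theorem abup_volume_unitCube_ne_top (d : ℕ) :
    volume {u : Fin d → ℝ | ∀ ι, 0 < u ι ∧ u ι < 1} ≠ ⊤ := by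
  refine ((measure_mono fun u hu => ?_).trans_lt
    (isCompact_Icc (a := (0 : Fin d → ℝ)) (b := 1)).measure_lt_top).ne
  exact ⟨fun ι => (hu ι).1.le, fun ι => (hu ι).2.le⟩

/-! ## `affineOrbitPairs` over finite index types -/

/-- **Affine-orbit pairs over finite index types** — `affineOrbitPairs` transported along
`Fintype.equivFin`. [folklore] -/
theorem abup_affineOrbitPairsFintype {d : ℕ} (B : Set (Fin d → ℝ)) (hB : IsSemialgebraic ℚ B)
    (hBvol : volume B ≠ ⊤) (I I' : Type) [Fintype I] [Fintype I'] (r r' : KZ.IntegralRep d)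
    (ρ : I → KZ.IntegralRep d) (ρ' : I' → KZ.IntegralRep d) (c : I → ℤ) (c' : I' → ℤ)
    (hr : ∀ x ∈ r.domain, r.integrand x = 1) (hr' : ∀ x ∈ r'.domain, r'.integrand x = 1)
    (hρ : ∀ i, ∀ x ∈ (ρ i).domain, (ρ i).integrand x = 1)
    (hρ' : ∀ i, ∀ x ∈ (ρ' i).domain, (ρ' i).integrand x = 1)
    (hc : ∀ i, c i ≠ 0 → ∃ (A : Matrix (Fin d) (Fin d) ℝ) (b : Fin d → ℝ),
      (∀ j l, IsAlgebraic ℚ (A j l)) ∧ (∀ j, IsAlgebraic ℚ (b j)) ∧ A.det ≠ 0 ∧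
      (ρ i).domain = (fun x => A.mulVec x + b) '' B)
    (hc' : ∀ i, c' i ≠ 0 → ∃ (A : Matrix (Fin d) (Fin d) ℝ) (b : Fin d → ℝ),
      (∀ j l, IsAlgebraic ℚ (A j l)) ∧ (∀ j, IsAlgebraic ℚ (b j)) ∧ A.det ≠ 0 ∧
      (ρ' i).domain = (fun x => A.mulVec x + b) '' B)
    (hdec : ∀ᵐ x : Fin d → ℝ, r.domain.indicator (fun _ => (1 : ℝ)) x =
      ∑ i, (c i : ℝ) * (ρ i).domain.indicator (fun _ => (1 : ℝ)) x)
    (hdec' : ∀ᵐ x : Fin d → ℝ, r'.domain.indicator (fun _ => (1 : ℝ)) x =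
      ∑ i, (c' i : ℝ) * (ρ' i).domain.indicator (fun _ => (1 : ℝ)) x)
    (hval : r.value = r'.value) : KZ.Equivalent r r' := by
  classical
  set e := Fintype.equivFin I with he
  set e' := Fintype.equivFin I' with he'
  refine affineOrbitPairs d B hB hBvol r r' (Fintype.card I) (Fintype.card I')
    (fun i => ρ (e.symm i)) (fun i => ρ' (e'.symm i)) (fun i => c (e.symm i))
    (fun i => c' (e'.symm i)) hr hr' (fun i => hρ (e.symm i)) (fun i => hρ' (e'.symm i))
    (fun i hi => hc (e.symm i) hi) (fun i hi => hc' (e'.symm i) hi) ?_ ?_ hval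
  · filter_upwards [hdec] with x hx
    rw [hx]
    exact (e.symm.sum_comp (fun i => (c i : ℝ) * (ρ i).domain.indicator (fun _ => (1 : ℝ)) x)).symm
  · filter_upwards [hdec'] with x hx
    rw [hx]
    exact (e'.symm.sum_comp
      (fun i => (c' i : ℝ) * (ρ' i).domain.indicator (fun _ => (1 : ℝ)) x)).symm

/-! ## Boxes: intersections and the affine parametrisation by the unit cube -/

/-- A finite intersection of open boxes is the open box whose lower corner is the coordinatewise
maximum of the lower corners (attained at `i₀ ι`) and whose upper corner is the coordinatewise
minimum of the upper corners (attained at `j₀ ι`). [folklore] -/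
theorem abup_biInter_box {d k : ℕ} (a b : Fin k → Fin d → ℝ) {S : Finset (Fin k)}
    (i₀ j₀ : Fin d → Fin k) (hi₀ : ∀ ι, i₀ ι ∈ S) (hj₀ : ∀ ι, j₀ ι ∈ S)
    (hmax : ∀ ι, ∀ i ∈ S, a i ι ≤ a (i₀ ι) ι) (hmin : ∀ ι, ∀ i ∈ S, b (j₀ ι) ι ≤ b i ι) :
    (⋂ i ∈ S, {x : Fin d → ℝ | ∀ ι, a i ι < x ι ∧ x ι < b i ι}) =
      {x : Fin d → ℝ | ∀ ι, a (i₀ ι) ι < x ι ∧ x ι < b (j₀ ι) ι} := by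
  ext x
  simp only [mem_iInter, mem_setOf_eq]
  exact ⟨fun h ι => ⟨(h _ (hi₀ ι) ι).1, (h _ (hj₀ ι) ι).2⟩,
    fun h i hi ι => ⟨(hmax ι i hi).trans_lt (h ι).1, (h ι).2.trans_le (hmin ι i hi)⟩⟩

/-- A non-degenerate open box `{A ι < x ι < B ι}` (`A < B` coordinatewise) is the affine image
`diag(B - A) · (0,1)ᵈ + A` of the open unit cube. [folklore] -/
theorem abup_box_eq_image {d : ℕ} (A B : Fin d → ℝ) (hAB : ∀ ι, A ι < B ι) :
    {x : Fin d → ℝ | ∀ ι, A ι < x ι ∧ x ι < B ι} =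
      (fun u => (Matrix.diagonal (B - A)).mulVec u + A) ''
        {u : Fin d → ℝ | ∀ ι, 0 < u ι ∧ u ι < 1} := by
  ext x
  simp only [mem_setOf_eq, mem_image]
  constructor
  · intro hx
    refine ⟨fun ι => (x ι - A ι) / (B ι - A ι), fun ι => ?_, funext fun ι => ?_⟩
    · have hBA : 0 < B ι - A ι := sub_pos.mpr (hAB ι)
      exact ⟨div_pos (sub_pos.mpr (hx ι).1) hBA,
        (div_lt_one hBA).mpr (sub_lt_sub_right (hx ι).2 _)⟩
    · have hBA : B ι - A ι ≠ 0 := (sub_pos.mpr (hAB ι)).ne'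
      rw [Pi.add_apply, Matrix.mulVec_diagonal, Pi.sub_apply, ← mul_div_assoc,
        mul_div_cancel_left₀ _ hBA, sub_add_cancel]
  · rintro ⟨u, hu, rfl⟩ ι
    have hBA : 0 < B ι - A ι := sub_pos.mpr (hAB ι)
    rw [Pi.add_apply, Matrix.mulVec_diagonal, Pi.sub_apply]
    refine ⟨lt_add_of_pos_left _ (mul_pos hBA (hu ι).1), ?_⟩
    have h := mul_lt_mul_of_pos_left (hu ι).2 hBA
    rw [mul_one] at h
    linarith

/-! ## The cells: one integrand-`1` representation per non-empty index set -/

/-- For non-empty `S`, the intersection of the boxes `BOX i`, `i ∈ S`, carries an integrand-`1`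
representation, and it is either empty or a real-algebraic affine image `diag(B - A) · (0,1)ᵈ + A`
(`det ≠ 0`) of the open unit cube, the corners `A`, `B` being corners of some `BOX i`.
[folklore] -/
theorem abup_cell {d k : ℕ} (a b : Fin k → Fin d → ℝ) (ha : ∀ i ι, IsAlgebraic ℚ (a i ι))
    (hb : ∀ i ι, IsAlgebraic ℚ (b i ι)) {S : Finset (Fin k)} (hS : S.Nonempty) :
    ∃ ρ : KZ.IntegralRep d, (ρ.integrand = fun _ => 1) ∧
      ρ.domain = ⋂ i ∈ S, {x : Fin d → ℝ | ∀ ι, a i ι < x ι ∧ x ι < b i ι} ∧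
      (ρ.domain = ∅ ∨ ∃ (M : Matrix (Fin d) (Fin d) ℝ) (v : Fin d → ℝ),
        (∀ j l, IsAlgebraic ℚ (M j l)) ∧ (∀ j, IsAlgebraic ℚ (v j)) ∧ M.det ≠ 0 ∧
        ρ.domain = (fun x => M.mulVec x + v) '' {u : Fin d → ℝ | ∀ ι, 0 < u ι ∧ u ι < 1}) := by
  classical
  -- the coordinatewise extremal corners
  choose i₀ hi₀ hmax using fun ι : Fin d => Finset.exists_max_image S (fun i => a i ι) hS
  choose j₀ hj₀ hmin using fun ι : Fin d => Finset.exists_min_image S (fun i => b i ι) hS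
  have hInter := abup_biInter_box a b i₀ j₀ hi₀ hj₀ hmax hmin
  by_cases hlt : ∀ ι, a (i₀ ι) ι < b (j₀ ι) ι
  · -- non-degenerate: the intersection box is an affine image of the unit cube
    have himg := abup_box_eq_image (fun ι => a (i₀ ι) ι) (fun ι => b (j₀ ι) ι) hlt
    have hM : ∀ j l, IsAlgebraic ℚ
        (Matrix.diagonal ((fun ι => b (j₀ ι) ι) - fun ι => a (i₀ ι) ι) j l) := by
      intro j l
      rcases eq_or_ne j l with rfl | hjl
      · rw [Matrix.diagonal_apply_eq, Pi.sub_apply]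
        exact (hb _ _).sub (ha _ _)
      · rw [Matrix.diagonal_apply_ne _ hjl]
        exact isAlgebraic_zero
    have hv : ∀ j, IsAlgebraic ℚ (a (i₀ j) j) := fun j => ha _ _
    have hsa : IsSemialgebraic ℚ
        {x : Fin d → ℝ | ∀ ι, a (i₀ ι) ι < x ι ∧ x ι < b (j₀ ι) ι} := by
      rw [himg]
      exact IsSemialgebraicMapOn.isSemialgebraic_image_holds
        (HyperbolicBloch.OffTetraSectorKernel.aff_orbit_isSemialgebraicMapOn hM hv
          isSemialgebraic_univ)
        (subset_univ _) (abup_isSemialgebraic_unitCube d)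
    have hvol : volume {x : Fin d → ℝ | ∀ ι, a (i₀ ι) ι < x ι ∧ x ι < b (j₀ ι) ι} ≠ ⊤ := by
      refine ((measure_mono fun x hx => ?_).trans_lt
        (isCompact_Icc (a := fun ι => a (i₀ ι) ι) (b := fun ι => b (j₀ ι) ι)).measure_lt_top).ne
      exact ⟨fun ι => (hx ι).1.le, fun ι => (hx ι).2.le⟩
    obtain ⟨ρ, hρd, hρi⟩ := KZ.exists_oneRep hsa hvol
    refine ⟨ρ, hρi, by rw [hρd, hInter], Or.inr ⟨_, _, hM, hv, ?_, by rw [hρd, himg]⟩⟩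
    rw [Matrix.det_diagonal]
    exact Finset.prod_ne_zero_iff.mpr fun ι _ => (sub_pos.mpr (hlt ι)).ne'
  · -- degenerate: the intersection is empty
    obtain ⟨ι, hι⟩ := not_forall.mp hlt
    have hempty : {x : Fin d → ℝ | ∀ ι, a (i₀ ι) ι < x ι ∧ x ι < b (j₀ ι) ι} = ∅ :=
      eq_empty_of_forall_notMem fun x hx => hι ((hx ι).1.trans (hx ι).2)
    obtain ⟨ρ, hρd, hρi⟩ := KZ.exists_oneRep (n := d) (σ := ∅) isSemialgebraic_empty
      (by rw [measure_empty]; exact ENNReal.zero_ne_top)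
    exact ⟨ρ, hρi, by rw [hρd, hInter, hempty], Or.inl hρd⟩

/-! ## One side: cells, weights, affine data and the decomposition -/

/-- **One side of the pair.** For a finite union `⋃ i, BOX i` of open boxes with real algebraic
corners: cells `ρ S` (`S : Finset (Fin k)`; for non-empty `S` an integrand-`1` representation on
`⋂ i ∈ S, BOX i`), inclusion–exclusion weights `c S = (-1)^{|S|+1}` (`0` for `S = ∅` and for
empty cells), real-algebraic affine data over the unit cube wherever `c S ≠ 0`, and the
decomposition `𝟙_{⋃ BOX i} = Σ_S c S · 𝟙_{dom ρ S}` (inclusion–exclusion for indicators).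
[folklore] -/
theorem abup_side {d k : ℕ} (a b : Fin k → Fin d → ℝ) (ha : ∀ i ι, IsAlgebraic ℚ (a i ι))
    (hb : ∀ i ι, IsAlgebraic ℚ (b i ι)) {r : KZ.IntegralRep d}
    (hr : r.domain = ⋃ i : Fin k, {x : Fin d → ℝ | ∀ ι, a i ι < x ι ∧ x ι < b i ι}) :
    ∃ (ρ : Finset (Fin k) → KZ.IntegralRep d) (c : Finset (Fin k) → ℤ),
      (∀ S, ∀ x ∈ (ρ S).domain, (ρ S).integrand x = 1) ∧
      (∀ S, c S ≠ 0 → ∃ (M : Matrix (Fin d) (Fin d) ℝ) (v : Fin d → ℝ),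
        (∀ j l, IsAlgebraic ℚ (M j l)) ∧ (∀ j, IsAlgebraic ℚ (v j)) ∧ M.det ≠ 0 ∧
        (ρ S).domain = (fun x => M.mulVec x + v) ''
          {u : Fin d → ℝ | ∀ ι, 0 < u ι ∧ u ι < 1}) ∧
      (∀ᵐ x : Fin d → ℝ, r.domain.indicator (fun _ => (1 : ℝ)) x =
        ∑ S, (c S : ℝ) * (ρ S).domain.indicator (fun _ => (1 : ℝ)) x) := by
  classical
  -- a dummy cell with empty domain for `S = ∅` (its weight is `0`)
  obtain ⟨ρ₀, -, hρ₀i⟩ := KZ.exists_oneRep (n := d) (σ := ∅) isSemialgebraic_empty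
    (by rw [measure_empty]; exact ENNReal.zero_ne_top)
  have hcell : ∀ S : Finset (Fin k), ∃ ρ : KZ.IntegralRep d, (ρ.integrand = fun _ => 1) ∧
      (S.Nonempty → ρ.domain = ⋂ i ∈ S, {x : Fin d → ℝ | ∀ ι, a i ι < x ι ∧ x ι < b i ι} ∧
        (ρ.domain = ∅ ∨ ∃ (M : Matrix (Fin d) (Fin d) ℝ) (v : Fin d → ℝ),
          (∀ j l, IsAlgebraic ℚ (M j l)) ∧ (∀ j, IsAlgebraic ℚ (v j)) ∧ M.det ≠ 0 ∧
          ρ.domain = (fun x => M.mulVec x + v) ''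
            {u : Fin d → ℝ | ∀ ι, 0 < u ι ∧ u ι < 1})) := by
    intro S
    by_cases hS : S.Nonempty
    · obtain ⟨ρ, hρi, hρd, hρc⟩ := abup_cell a b ha hb hS
      exact ⟨ρ, hρi, fun _ => ⟨hρd, hρc⟩⟩
    · exact ⟨ρ₀, hρ₀i, fun h => (hS h).elim⟩
  choose ρ hρi hρS using hcell
  refine ⟨ρ, fun S => if S.Nonempty ∧ (ρ S).domain.Nonempty then (-1) ^ (S.card + 1) else 0,
    fun S x _ => by rw [hρi S], fun S hS => ?_, ?_⟩
  · -- affine data (only non-empty `S` with non-empty cell have non-zero weight)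
    have h : S.Nonempty ∧ (ρ S).domain.Nonempty := by
      by_contra h
      exact hS (if_neg h)
    obtain ⟨-, h0 | h1⟩ := hρS S h.1
    · exact absurd h.2 (by rw [h0]; exact not_nonempty_empty)
    · exact h1
  · -- the decomposition holds everywhere: inclusion–exclusion for indicator functions
    refine Filter.Eventually.of_forall fun x => ?_
    rw [hr]
    refine (stub_indicatorInclusionExclusion _ k _ x).trans (Finset.sum_congr rfl fun S _ => ?_)
    by_cases hSne : S.Nonempty
    · obtain ⟨hdom, -⟩ := hρS S hSne
      rw [← hdom]
      by_cases hD : (ρ S).domain.Nonempty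
      · simp [hSne, hD]
      · rw [not_nonempty_iff_eq_empty] at hD
        simp [hD]
    · simp [hSne]

/-! ## The stub -/

/-- **Stub (ALGEBRAIC BOX-UNION PAIRS, Euclidean).** Two integrand-`1` representations of
dimension `d` whose domains are finite unions of open boxes `{a i ι < x ι < b i ι}` with real
algebraic corners (overlaps, degenerate and empty boxes allowed, any position) and whose values
agree are KZ-equivalent — `affineOrbitPairs` over the open unit cube with cells the intersections
`⋂ i ∈ S, BOX i` (again boxes, affine images `diag(B - A) · (0,1)ᵈ + A` of the cube),
inclusion–exclusion weights `(-1)^{|S|+1}` (`stub_indicatorInclusionExclusion`), zero weight on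
empty cells. [folklore] -/
theorem stub_algebraicBoxUnionPairs : ∀ (d k k' : ℕ) (a b : Fin k → Fin d → ℝ) (a' b' : Fin k' → Fin d → ℝ) (r r' : KZ.IntegralRep d),
    (∀ i ι, IsAlgebraic ℚ (a i ι)) → (∀ i ι, IsAlgebraic ℚ (b i ι)) →
    (∀ i ι, IsAlgebraic ℚ (a' i ι)) → (∀ i ι, IsAlgebraic ℚ (b' i ι)) →
    r.domain = ⋃ i : Fin k, {x : Fin d → ℝ | ∀ ι, a i ι < x ι ∧ x ι < b i ι} →
    r'.domain = ⋃ i : Fin k', {x : Fin d → ℝ | ∀ ι, a' i ι < x ι ∧ x ι < b' i ι} →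
    (∀ x ∈ r.domain, r.integrand x = 1) → (∀ x ∈ r'.domain, r'.integrand x = 1) →
    r.value = r'.value → KZ.Equivalent r r' := by
  intro d k k' a b a' b' r r' ha hb ha' hb' hr hr' hr1 hr1' hval
  obtain ⟨ρ, c, hρ, hc, hdec⟩ := abup_side a b ha hb hr
  obtain ⟨ρ', c', hρ', hc', hdec'⟩ := abup_side a' b' ha' hb' hr'
  exact abup_affineOrbitPairsFintype _ (abup_isSemialgebraic_unitCube d)
    (abup_volume_unitCube_ne_top d) (Finset (Fin k)) (Finset (Fin k')) r r' ρ ρ' c c'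
    hr1 hr1' hρ hρ' hc hc' hdec hdec' hval

end Summit.KontsevichZagierPeriods.SymplecticScissors.LogPolytope

end
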